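import Summits.QuantumFields.BalabanUV.Beta.FP.TowerDoorRecordGaugeLetter
import Summits.QuantumFields.BalabanUV.Beta.FP.TowerDoorGaugePeriodisedGS
import Summits.QuantumFields.BalabanUV.Beta.FP.TowerDoorRecordDefsGS

/-!
# `BalabanUV.Beta.FP.TowerDoorRecordGaugeLetterGS` — binder row D1 ∕ (C1), **THE END's `hlv` LINE FOR THE L DOOR AS A THEOREM — `hlv_recGS`** = PART 77 `TowerDoorRecordGaugeLetter.hlv_rec`
# with the leg letters `hEAN hLN` read at the `σₙ`-conjugated L-chart `scaleK σₙ σₙ (ANs ρ_c Ψ̂ˢ (n+1))` (S-END-G's display) and the conclusion's gauge function the L record's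
# `lamRecGS Lc (QSym Lc) (sn n) n` (gen-94 `TowerDoorRecordDefsGS`), EVERY other binder CHARACTER FOR CHARACTER; fed by gen-95 `TowerDoorGaugePeriodisedGS.lv_smul_single_eq_tsum_lamZ_at_pins_symL`
# (β-function cell `pub-balaban`, BINDER-OWNERS row D1 ∕ (C1) OWNER «beta-an2» gen 95; director-ym g24 [DIRYM-G24-INBOX-7] (3) «`hWΔT` BY NAME»: with this file the (T2) letter `hWΔT_recGS`'s
# displayed `hlv` is a theorem at v10's rows from S-END-G's own binders + `h2`, exactly as PART 77 made PART 74's).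

WHAT ([folklore] BY NAME; no `def`, no `def … : Prop`, nothing cited, 0 sorry): §1 `lamRecGS_QSym_eq_lamZ` (`rfl`); §2 **`hlv_recGS`**.
WHAT THIS IS NOT: `h2` is NOT discharged (displayed, as PART 77; the road's `h2_rec`∕`h2_rec_rooted` discharge its twins at the record); NO display of S-END-G is discharged; the END is NOT
instantiated; ZERO weight on `hlawLG` (THE CRUX — OPEN by name) ∕ `hG` ∕ `hF₁` ∕ (J-m2)″; nothing of Bałaban's asserted, valued or discharged; 0 estimates; 0∕4 row-D1 binders (hW, hR, D1Tel,
D1Rep); S-END-G ✓ p830965 and suppliers UNTOUCHED; ROOT M‴ p325680 ∕ P5c ∕ D6 untouched; NOT (C1), NOT (T-ID), NOT D1, NEVER «G-an2-4 closed», NOT BetaPertH, NOT continuum, NOT Clay.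

HONEST DEPENDENCY (page 1, mandatory): continuum YM on T⁴ ⇐ BetaPertH ∧ nine spine estimates (0/9 proved); BetaPertH ⇐ (D1) ∧ (D4) ∧ CAP+tail;
G-an2-4 gates asym, D1 and NE2/3/4.  HONEST FRAMING (cell contract, verbatim): «discharging `BetaPertH` makes Bałaban's UV stability UNCONDITIONAL —
a real constructive-QFT result; it is NOT the continuum limit and NOT the Clay problem.»  ABSOLUTE RULE (cell charter, verbatim): «No internally-minted
statement may enter as a cited fact. Every hypothesis is either kernel-proved in this package or a verbatim quotation of a PUBLISHED theorem with page
reference. The manuscript(s) under audit are NOT citable for their own disputed steps — they are the thing under adjudication; programme-internal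
(2001/route/tribunal) claims are never citable.»  Row D1 ∕ (C1) OWNER «beta-an2» gen 95, 2026-08-31.  No existing file touched.
-/

noncomputable section

open Finset Matrix Filter
open scoped BigOperators Matrix Topology
open Literature.Probability.LatticeModels (Torus.proj)
open Literature.MathematicalPhysics.QuantumFieldTheory
open Literature.MathematicalPhysics.QuantumFieldTheory.Balaban1983to89
open Literature.MathematicalPhysics.QuantumFieldTheory.Balaban1983to89.Beta
open Literature.MathematicalPhysics.QuantumFieldTheory.Balaban1983to89.Beta.Composition (kkt)
open Literature.MathematicalPhysics.QuantumFieldTheory.Balaban1983to89.Beta.CompositionSingular (effForm minOp)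
open B4TorusKernel.MultiPeriod (translate)
open B5Prop11Plancherel (fine)
open B6Lemma24Torus (pbox wrap)
open AffineAveraging (Site box toSite unitVec)
open AveragingContoursRooted (ctrOff ctrOff_mem_box)
open OneStepResolventKernel (Fib)
open ExpKernelCalculus (MKer shiftK)
open HessKerRate (scaleK)
open Literature.MathematicalPhysics.QuantumFieldTheory.LatticeForm (quo)
open Summit.QuantumFields.BalabanUV.Beta.AxialDressingRooted (axEc)
open Summit.QuantumFields.BalabanUV.Beta.SymShiftedSpread (bhKStepSh)
open Summit.QuantumFields.BalabanUV.Beta.DshAn1 (Dsh)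
open Summit.QuantumFields.BalabanUV.Beta.CompositeOneShotJetData (Roots)
open Summit.QuantumFields.BalabanUV.Beta.FP.KernelPeriodisationFib (Idx perF perZ)
open Summit.QuantumFields.BalabanUV.Beta.FP.TorusGaugeCovariancePairing (wrapPt wrapPt_coe)
open Summit.QuantumFields.BalabanUV.Beta.FP.TorusGaugeCovarianceCoarse (coarsePt)
open Summit.QuantumFields.BalabanUV.Beta.FP.TorusCombRows (Res)
open Summit.QuantumFields.BalabanUV.Beta.FP.TorusCompositeObjects (towerTorus towerTorus_apply NParam combF bigP towerGen bigRoot bigRatio bigRatio_eq_pow towerEquiv)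
open Summit.QuantumFields.BalabanUV.Beta.FP.TorusCompositeObjectsG (compRowsSym)
open Summit.QuantumFields.BalabanUV.Beta.FP.TorusCompositeUnimodular (towerEvalC)
open Summit.QuantumFields.BalabanUV.Beta.GAN24.FineReadoutCauchyFrame (toSite_mem_range)
open Summit.QuantumFields.BalabanUV.Beta.FP.NestedStepLawTorusInstance (coarseSlot_injective coarseSlot_range)
open Summit.QuantumFields.BalabanUV.Beta.FP.TorusCompositeSliceOneShotG (torus_hTW_oneShot_towerSym)
open Summit.QuantumFields.BalabanUV.Beta.FP.TorusCompositeCovarianceSym (compRowsSym_mul_towerGen_succ)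
open Summit.QuantumFields.BalabanUV.Beta.FP.TowerDoorGaugeRefDefs (lamZ)
open Summit.QuantumFields.BalabanUV.Beta.FP.TowerDoorGaugePeriodisedGS (lv_smul_single_eq_tsum_lamZ_at_pins_symL)
open Summit.QuantumFields.BalabanUV.Beta.FP.TowerDoorRecordDefsGS (lamRecGS)
open Summit.QuantumFields.BalabanUV.Beta.CompositeCorrectorKernelSym (psiKSym)
open Summit.QuantumFields.BalabanUV.Beta.FP.CompositeOneShotJetDataSym (ANs)
open Summit.QuantumFields.BalabanUV.Beta.FP.StepRecursionSymEnd (ΨL)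
open Summit.QuantumFields.BalabanUV.Beta.FP.TorusCompositeObjectsG (QSym)

namespace Summit.QuantumFields.BalabanUV.Beta.FP.TowerDoorRecordGaugeLetterGS

variable (Lc : ℕ) [NeZero Lc]

/-! ## §1 The L record gauge function at v10's rows IS PART 55's lattice gauge function at the L-chart (`rfl`) -/

/-- [folklore] **`lamRecGS_QSym_eq_lamZ`** — gen-94 `lamRecGS Lc (QSym Lc) sn n` (PART 81 `lamZG` at v10's step rows `QSym Lc`) unfolds, by `rfl` (PART 81 `lamZG_QSym`), to PART 55's `lamZ` at v10's levels
`fun i => n+1−i`, the centred roots and the `σₙ`-conjugated L-chart `scaleK σₙ σₙ (ANs ρ_c Ψ̂ˢ (n+1))` — PART 77 `lamRec_eq_lamZ` at the L-chart. -/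
theorem lamRecGS_QSym_eq_lamZ (sn : ℝ) (n : ℕ) :
    lamRecGS Lc (QSym Lc) sn n = lamZ Lc (fun i : ℕ => n + 1 - i) (fun _ : ℕ => ctrOff (3 + 1) Lc)
      (fun _ => toSite_mem_range (ctrOff_mem_box (d := 3 + 1) (Nat.one_le_iff_ne_zero.mpr (NeZero.ne Lc)))) n
      (scaleK (Sum.elim (fun _ : Fin (3 + 1) => (1 : ℝ)) (fun _ : Fin (3 + 1) => sn⁻¹)) (Sum.elim (fun _ : Fin (3 + 1) => (1 : ℝ)) (fun _ : Fin (3 + 1) => sn⁻¹))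
        (ANs (Roots.ctr Lc) (ΨL (Roots.ctr Lc)) (n + 1))) := rfl

/-! ## §2 The END's `hlv` line -/

/-- [folklore] **`hlv_recGS` — gen-95 `hWΔT_recGS`'s letter `hlv` AT v10's ROWS `Q := QSym Lc`, DERIVED FROM S-END-G's OWN BINDERS**: under S-END∕S-END-G's binders `H₀ … hLN`, `XF hXF`
(CHARACTER FOR CHARACTER — `hEAN hLN` at the `σₙ`-conjugated L-chart `scaleK σₙ σₙ (ANs ρ_c Ψ̂ˢ (n+1))` as S-END-G ✓ p830965 displays them) and the skeleton's non-degeneracy letter `h2` (as PART 77), for every `n B μ y s`: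
`lv n B ((sn n·r n)•e_(wrapPt (Mc B) y, μ)) s = (sn n·r n) · Σ'_m lamRecGS Lc (QSym Lc) (sn n) n μ (translate (Mc B) ↑(wrapPt (Mc B) y) m) ↑s` — gen-95 `lv_smul_single_eq_tsum_lamZ_at_pins_symL` per source with
PART 77's instantiation map VERBATIM, `rw [lamRecGS_QSym_eq_lamZ]; exact`.  ZERO weight on `hlawLG`. -/
theorem hlv_recGS (Mc : ℕ → (Fin (3 + 1) → ℕ)) [∀ B μ, NeZero (Mc B μ)] (sn : ℕ → ℝ) (r : ∀ n : ℕ, ℝ)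
    {H₀ : ∀ n : ℕ, ∀ B : ℕ, Matrix (↥(pbox (towerTorus Lc (fine Lc (Mc B)) (n + 1))) × Fin (3 + 1)) (↥(pbox (towerTorus Lc (fine Lc (Mc B)) (n + 1))) × Fin (3 + 1)) ℝ}
    {Q₁₀ : ∀ n : ℕ, ∀ B : ℕ, Matrix (↥(pbox (fine Lc (Mc B))) × Fin (3 + 1)) (↥(pbox (towerTorus Lc (fine Lc (Mc B)) (n + 1))) × Fin (3 + 1)) ℝ}
    {τ₁ : ∀ n : ℕ, ∀ B : ℕ, Matrix (NParam Lc (fine Lc (fine Lc (Mc B))) (fun k => (fun _ : ℕ => ctrOff (3 + 1) Lc) (k + 1)) n) (↥(pbox (towerTorus Lc (fine Lc (Mc B)) (n + 1))) × Fin (3 + 1)) ℝ}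
    (hH₀ : ∀ n : ℕ, ∀ B : ℕ, ((H₀ n) B) = (perF (towerTorus Lc (fine Lc (Mc B)) (n + 1)) (bhKStepSh 3 Lc (Dsh Lc) ((n + 1 - (n + 1))))).submatrix (fun b : (↥(pbox (towerTorus Lc (fine Lc (Mc B)) (n + 1))) × Fin (3 + 1)) => ((b.1, Sum.inl b.2) : Idx (towerTorus Lc (fine Lc (Mc B)) (n + 1)) (Fib 3))) (fun b : (↥(pbox (towerTorus Lc (fine Lc (Mc B)) (n + 1))) × Fin (3 + 1)) => ((b.1, Sum.inl b.2) : Idx (towerTorus Lc (fine Lc (Mc B)) (n + 1)) (Fib 3))))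
    (hQ₁₀ : ∀ n : ℕ, ∀ B : ℕ, ((Q₁₀ n) B) = compRowsSym Lc (fine Lc (Mc B)) (fun i : ℕ => n + 1 - i) (fun _ : ℕ => ctrOff (3 + 1) Lc) (n + 1))
    (hτ₁ : ∀ n : ℕ, ∀ B : ℕ, ((τ₁ n) B) = bigP Lc (fine Lc (fine Lc (Mc B))) (fun k => (fun _ : ℕ => ctrOff (3 + 1) Lc) (k + 1)) (fun _ => toSite_mem_range (ctrOff_mem_box (d := 3 + 1) (Nat.one_le_iff_ne_zero.mpr (NeZero.ne Lc)))) n)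
    {τ₂ : ∀ n : ℕ, ∀ B : ℕ, Matrix (Res (toSite (ctrOff (3 + 1) Lc)) Lc (fine Lc (Mc B))) (↥(pbox (fine Lc (Mc B))) × Fin (3 + 1)) ℝ}
    (hτ₂ : ∀ n : ℕ, ∀ B : ℕ, ((τ₂ n) B) = combF Lc (fine Lc (Mc B)) ((fun _ : ℕ => ctrOff (3 + 1) Lc) 0))
    {Q₂₀ : ∀ n : ℕ, ∀ B : ℕ, Matrix ((↥(pbox (Mc B)) × Fin (3 + 1))) (↥(pbox (fine Lc (Mc B))) × Fin (3 + 1)) ℝ}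
    (hQ₂₀ : ∀ n : ℕ, ∀ B : ℕ, ((Q₂₀ n) B) = (perF (fine Lc (Mc B)) (bhKStepSh 3 Lc (Dsh Lc) ((n + 1 - 0)))).submatrix (fun a : ((↥(pbox (Mc B)) × Fin (3 + 1))) => ((coarsePt (Mc B) Lc a.1, Sum.inr (a.2)) : Idx (fine Lc (Mc B)) (Fib 3))) (fun b : ↥(pbox (fine Lc (Mc B))) × Fin (3 + 1) => ((b.1, Sum.inl b.2) : Idx (fine Lc (Mc B)) (Fib 3))))
    {W₀ : ∀ n : ℕ, ∀ B : ℕ, Matrix (↥(pbox (towerTorus Lc (fine Lc (Mc B)) (n + 1))) × Fin (3 + 1)) (NParam Lc (fine Lc (Mc B)) (fun _ : ℕ => ctrOff (3 + 1) Lc) (n + 1)) ℝ}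
    (hW₀ : ∀ n : ℕ, ∀ B : ℕ, ((W₀ n) B) = towerGen Lc (fine Lc (Mc B)) (fun _ : ℕ => ctrOff (3 + 1) Lc) (n + 1))
    {P : ∀ n : ℕ, ∀ B : ℕ, Matrix (NParam Lc (fine Lc (Mc B)) (fun _ : ℕ => ctrOff (3 + 1) Lc) (n + 1)) (↥(pbox (towerTorus Lc (fine Lc (Mc B)) (n + 1))) × Fin (3 + 1)) ℝ}
    (hP : ∀ n : ℕ, ∀ B : ℕ, ((P n) B) = bigP Lc (fine Lc (Mc B)) (fun _ : ℕ => ctrOff (3 + 1) Lc) (fun _ => toSite_mem_range (ctrOff_mem_box (d := 3 + 1) (Nat.one_le_iff_ne_zero.mpr (NeZero.ne Lc)))) (n + 1))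
    {I : ∀ n : ℕ, ∀ B : ℕ, Matrix (↥(pbox (towerTorus Lc (fine Lc (Mc B)) (n + 1))) × Fin (3 + 1)) ((↥(pbox (fine Lc (Mc B))) × Fin (3 + 1)) ⊕ (NParam Lc (fine Lc (fine Lc (Mc B))) (fun k => (fun _ : ℕ => ctrOff (3 + 1) Lc) (k + 1)) n)) ℝ}
    {S : ∀ n : ℕ, ∀ B : ℕ, Matrix ((↥(pbox (fine Lc (Mc B))) × Fin (3 + 1)) ⊕ (NParam Lc (fine Lc (fine Lc (Mc B))) (fun k => (fun _ : ℕ => ctrOff (3 + 1) Lc) (k + 1)) n)) ((↥(pbox (fine Lc (Mc B))) × Fin (3 + 1)) ⊕ (NParam Lc (fine Lc (fine Lc (Mc B))) (fun k => (fun _ : ℕ => ctrOff (3 + 1) Lc) (k + 1)) n)) ℝ}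
    (hI : ∀ n : ℕ, ∀ B : ℕ, minOp ((H₀ n) B) (fromRows ((Q₁₀ n) B) ((τ₁ n) B)) = ((I n) B))
    (hS : ∀ n : ℕ, ∀ B : ℕ, effForm ((H₀ n) B) (fromRows ((Q₁₀ n) B) ((τ₁ n) B)) = ((S n) B))
    {𝔔₀ : ∀ n : ℕ, ∀ B : ℕ, Matrix ((↥(pbox (Mc B)) × Fin (3 + 1))) (↥(pbox (towerTorus Lc (fine Lc (Mc B)) (n + 1))) × Fin (3 + 1)) ℝ}
    (h𝔔₀ : ∀ n : ℕ, ∀ B : ℕ, ((Q₂₀ n) B) * ((Q₁₀ n) B) = ((𝔔₀ n) B))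
    {hv : ∀ n : ℕ, ∀ B : ℕ, ((↥(pbox (Mc B)) × Fin (3 + 1)) → ℝ) → ((↥(pbox (towerTorus Lc (fine Lc (Mc B)) (n + 1))) × Fin (3 + 1)) → ℝ)}
    (hhv : ∀ n : ℕ, ∀ B : ℕ, ∀ v, ((hv n) B) v = ((I n) B) *ᵥ Sum.elim (minOp ((S n) B).toBlocks₁₁ (fromRows ((Q₂₀ n) B) ((τ₂ n) B)) *ᵥ Sum.elim v 0) 0)
    (lv : ∀ n : ℕ, ∀ B : ℕ, ((↥(pbox (Mc B)) × Fin (3 + 1)) → ℝ) → (↥(pbox (towerTorus Lc (fine Lc (Mc B)) (n + 1))) → ℝ))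
    (hlve : ∀ n : ℕ, ∀ B : ℕ, ∀ (v : ((↥(pbox (Mc B)) × Fin (3 + 1)) → ℝ)) (s : ↥(pbox (towerTorus Lc (fine Lc (Mc B)) (n + 1)))), ((lv n) B) v s = -(∑ x : Res (bigRoot Lc (fun _ : ℕ => ctrOff (3 + 1) Lc) (n + 1)) (bigRatio Lc (n + 1)) (towerTorus Lc (fine Lc (Mc B)) (n + 1)), (if (x.1 : ↥(pbox (towerTorus Lc (fine Lc (Mc B)) (n + 1)))) = s then (towerEvalC Lc (fine Lc (Mc B)) (fun _ : ℕ => ctrOff (3 + 1) Lc) (fun _ => toSite_mem_range (ctrOff_mem_box (d := 3 + 1) (Nat.one_le_iff_ne_zero.mpr (NeZero.ne Lc)))) (n + 1) *ᵥ ((((P n) B) * ((W₀ n) B))⁻¹ *ᵥ (((P n) B) *ᵥ ((hv n) B) v))) (towerEquiv Lc (fine Lc (Mc B)) (fun _ : ℕ => ctrOff (3 + 1) Lc) (fun _ => toSite_mem_range (ctrOff_mem_box (d := 3 + 1) (Nat.one_le_iff_ne_zero.mpr (NeZero.ne Lc)))) (n + 1) x) else 0)))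
    {XN : ∀ n : ℕ, ∀ B : ℕ, Matrix ((↥(pbox (towerTorus Lc (fine Lc (Mc B)) (n + 1))) × Fin (3 + 1)) ⊕ ((↥(pbox (Mc B)) × Fin (3 + 1)) ⊕ (NParam Lc (fine Lc (Mc B)) (fun _ : ℕ => ctrOff (3 + 1) Lc) (n + 1)))) ((↥(pbox (towerTorus Lc (fine Lc (Mc B)) (n + 1))) × Fin (3 + 1)) ⊕ ((↥(pbox (Mc B)) × Fin (3 + 1)) ⊕ (NParam Lc (fine Lc (Mc B)) (fun _ : ℕ => ctrOff (3 + 1) Lc) (n + 1)))) ℝ}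
    (hXN : ∀ n : ℕ, ∀ B : ℕ, kkt ((H₀ n) B) (fromRows ((𝔔₀ n) B) ((P n) B)) * (XN n) B = 1)
    (ρN : ∀ n : ℕ, Fin (3 + 1) → ℤ)
    (fN : ∀ n : ℕ, ∀ B : ℕ, (↥(pbox (Mc B)) × Fin (3 + 1)) → Idx (towerTorus Lc (fine Lc (Mc B)) (n + 1)) (Fib 3))
    (hfN : ∀ n : ℕ, ∀ B : ℕ, ∀ a : ↥(pbox (Mc B)) × Fin (3 + 1), (fN n) B a = (wrapPt (towerTorus Lc (fine Lc (Mc B)) (n + 1)) (((Lc ^ (n + 1 + 1) : ℕ) : ℤ) • (a.1 : Site (3 + 1))), Sum.inr a.2))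
    (hEAN : ∀ n : ℕ, ∀ B : ℕ, perF (towerTorus Lc (fine Lc (Mc B)) (n + 1)) (axEc (ρN n) (Lc ^ (n + 1 + 1))) * perF (towerTorus Lc (fine Lc (Mc B)) (n + 1)) (scaleK (Sum.elim (fun _ : Fin (3 + 1) => (1 : ℝ)) (fun _ : Fin (3 + 1) => (sn n)⁻¹)) (Sum.elim (fun _ : Fin (3 + 1) => (1 : ℝ)) (fun _ : Fin (3 + 1) => (sn n)⁻¹)) (ANs (Roots.ctr Lc) (ΨL (Roots.ctr Lc)) (n + 1))) = perF (towerTorus Lc (fine Lc (Mc B)) (n + 1)) (scaleK (Sum.elim (fun _ : Fin (3 + 1) => (1 : ℝ)) (fun _ : Fin (3 + 1) => (sn n)⁻¹)) (Sum.elim (fun _ : Fin (3 + 1) => (1 : ℝ)) (fun _ : Fin (3 + 1) => (sn n)⁻¹)) (ANs (Roots.ctr Lc) (ΨL (Roots.ctr Lc)) (n + 1))))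
    (hLN : ∀ n : ℕ, ∀ B : ℕ, ((XN n) B).submatrix (Sum.map id Sum.inl) (Sum.map id Sum.inl) = fromBlocks (Matrix.of fun (b b' : (↥(pbox (towerTorus Lc (fine Lc (Mc B)) (n + 1))) × Fin (3 + 1))) => axEc (ρN n) (Lc ^ (n + 1 + 1)) (b.1 : Site (3 + 1)) (b.1 : Site (3 + 1)) (Sum.inl b.2) (Sum.inl b.2) * (axEc (ρN n) (Lc ^ (n + 1 + 1)) (b'.1 : Site (3 + 1)) (b'.1 : Site (3 + 1)) (Sum.inl b'.2) (Sum.inl b'.2) * perF (towerTorus Lc (fine Lc (Mc B)) (n + 1)) (scaleK (Sum.elim (fun _ : Fin (3 + 1) => (1 : ℝ)) (fun _ : Fin (3 + 1) => (sn n)⁻¹)) (Sum.elim (fun _ : Fin (3 + 1) => (1 : ℝ)) (fun _ : Fin (3 + 1) => (sn n)⁻¹)) (ANs (Roots.ctr Lc) (ΨL (Roots.ctr Lc)) (n + 1))) (b.1, Sum.inl b.2) (b'.1, Sum.inl b'.2))) (Matrix.of fun (b : (↥(pbox (towerTorus Lc (fine Lc (Mc B)) (n + 1))) × Fin (3 +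 1))) (a : (↥(pbox (Mc B)) × Fin (3 + 1))) => axEc (ρN n) (Lc ^ (n + 1 + 1)) (b.1 : Site (3 + 1)) (b.1 : Site (3 + 1)) (Sum.inl b.2) (Sum.inl b.2) * perF (towerTorus Lc (fine Lc (Mc B)) (n + 1)) (scaleK (Sum.elim (fun _ : Fin (3 + 1) => (1 : ℝ)) (fun _ : Fin (3 + 1) => (sn n)⁻¹)) (Sum.elim (fun _ : Fin (3 + 1) => (1 : ℝ)) (fun _ : Fin (3 + 1) => (sn n)⁻¹)) (ANs (Roots.ctr Lc) (ΨL (Roots.ctr Lc)) (n + 1))) (b.1, Sum.inl b.2) (((fN n) B) a)) (-Matrix.of fun (a : (↥(pbox (Mc B)) × Fin (3 + 1))) (b : (↥(pbox (towerTorus Lc (fine Lc (Mc B)) (n + 1))) × Fin (3 + 1))) => axEc (ρN n) (Lc ^ (n + 1 + 1)) (b.1 : Site (3 + 1)) (b.1 : Site (3 + 1)) (Sum.inl b.2) (Sum.inl b.2) * perF (towerTorus Lc (fine Lc (Mc B)) (n + 1)) (scaleK (Sum.elim (fun _ : Fin (3 + 1) => (1 : ℝ)) (fun _ : Fin (3 +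 1) => (sn n)⁻¹)) (Sum.elim (fun _ : Fin (3 + 1) => (1 : ℝ)) (fun _ : Fin (3 + 1) => (sn n)⁻¹)) (ANs (Roots.ctr Lc) (ΨL (Roots.ctr Lc)) (n + 1))) (((fN n) B) a) (b.1, Sum.inl b.2)) (-((perF (towerTorus Lc (fine Lc (Mc B)) (n + 1)) (scaleK (Sum.elim (fun _ : Fin (3 + 1) => (1 : ℝ)) (fun _ : Fin (3 + 1) => (sn n)⁻¹)) (Sum.elim (fun _ : Fin (3 + 1) => (1 : ℝ)) (fun _ : Fin (3 + 1) => (sn n)⁻¹)) (ANs (Roots.ctr Lc) (ΨL (Roots.ctr Lc)) (n + 1)))).submatrix ((fN n) B) ((fN n) B))))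
    {XF : ∀ n : ℕ, ∀ B : ℕ, Matrix ((↥(pbox (towerTorus Lc (fine Lc (Mc B)) (n + 1))) × Fin (3 + 1)) ⊕ ((↥(pbox (fine Lc (Mc B))) × Fin (3 + 1)) ⊕ (NParam Lc (fine Lc (fine Lc (Mc B))) (fun k => (fun _ : ℕ => ctrOff (3 + 1) Lc) (k + 1)) n))) ((↥(pbox (towerTorus Lc (fine Lc (Mc B)) (n + 1))) × Fin (3 + 1)) ⊕ ((↥(pbox (fine Lc (Mc B))) × Fin (3 + 1)) ⊕ (NParam Lc (fine Lc (fine Lc (Mc B))) (fun k => (fun _ : ℕ => ctrOff (3 + 1) Lc) (k + 1)) n))) ℝ}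
    (hXF : ∀ n : ℕ, ∀ B : ℕ, kkt ((H₀ n) B) (fromRows ((Q₁₀ n) B) ((τ₁ n) B)) * (XF n) B = 1)
    (h2 : ∀ n : ℕ, ∀ B : ℕ, (kkt ((S n) B).toBlocks₁₁ (fromRows ((Q₂₀ n) B) ((τ₂ n) B))).det ≠ 0) :
    ∀ n : ℕ, ∀ B : ℕ, ∀ (μ : Fin (3 + 1)) (y : Site (3 + 1)) (s : ↥(pbox (towerTorus Lc (fine Lc (Mc B)) (n + 1)))),
      ((lv n) B) (((sn n) * (r n)) • (Pi.single (wrapPt (Mc B) y, μ) (1 : ℝ) : ((↥(pbox (Mc B)) × Fin (3 + 1)) → ℝ))) s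
        = ((sn n) * (r n)) * ∑' m : Site (3 + 1), lamRecGS Lc (QSym Lc) (sn n) n μ (translate (Mc B) ((wrapPt (Mc B) y : ↥(pbox (Mc B))) : Site (3 + 1)) m) (s : Site (3 + 1)) := by
  intro n B μ y s
  have h57 := lv_smul_single_eq_tsum_lamZ_at_pins_symL (R := Roots.ctr Lc) (M' := fine Lc (Mc B)) (Lc := Lc) (lev := fun i : ℕ => n + 1 - i) (n := n) (κ := ↥(pbox (Mc B)) × Fin (3 + 1))
    (H₀ := (H₀ n) B) (Q₁₀ := (Q₁₀ n) B) (τ₁ := (τ₁ n) B) (τ₂ := (τ₂ n) B) (Q₂₀ := (Q₂₀ n) B) (W₀ := (W₀ n) B) (P := (P n) B) (𝔔₀ := (𝔔₀ n) B) (I := (I n) B) (S := (S n) B) (hv := (hv n) B) (XN := (XN n) B)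
    (hrs := fun _ => ctrOff_mem_box (d := 3 + 1) (Nat.one_le_iff_ne_zero.mpr (NeZero.ne Lc)))
    (hlev := fun i hi => by show n + 1 - i = n + 1 - (i + 1) + 1; omega) (hM' := fun i => ⟨Mc B i, rfl⟩)
    (pμ' := fun a => coarsePt (Mc B) Lc a.1) (mμ' := fun a => a.2) (hfμ' := coarseSlot_injective (Mc B)) (hcoarse' := coarseSlot_range (Mc B))
    (hH₀ := hH₀ n B) (hQ₁₀ := hQ₁₀ n B) (hτ₁ := hτ₁ n B) (hτ₂ := hτ₂ n B) (hQ₂₀ := hQ₂₀ n B) (hW₀ := hW₀ n B) (hP := hP n B) (h𝔔₀ := h𝔔₀ n B) (hI := hI n B) (hS := hS n B)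
    (hhv := hhv n B) (hXN := hXN n B) (h1 := (Matrix.isUnit_det_of_right_inverse (hXF n B)).ne_zero) (h2 := h2 n B)
    (hTW := torus_hTW_oneShot_towerSym (fine Lc (Mc B)) Lc (fun i : ℕ => n + 1 - i) (fun _ : ℕ => ctrOff (3 + 1) Lc) n
      (fun _ => ctrOff_mem_box (d := 3 + 1) (Nat.one_le_iff_ne_zero.mpr (NeZero.ne Lc))) (fun i => ⟨Mc B i, rfl⟩)
      (compRowsSym_mul_towerGen_succ Lc (ctrOff_mem_box (d := 3 + 1) (Nat.one_le_iff_ne_zero.mpr (NeZero.ne Lc))) n (fine Lc (Mc B)) (fun i : ℕ => n + 1 - i))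
      (hQ₁₀ n B) (hτ₁ n B) (hτ₂ n B) (hW₀ n B)) (Mc := Mc B) (hMc := fun i => rfl)
    (σ := Sum.elim (fun _ : Fin (3 + 1) => (1 : ℝ)) (fun _ : Fin (3 + 1) => (sn n)⁻¹)) (ρN := ρN n) (LNc := Lc ^ (n + 1 + 1)) (fN := (fN n) B) (hEAN := hEAN n B) (hLN := hLN n B)
    (a := (wrapPt (Mc B) y, μ)) (w := ((wrapPt (Mc B) y : ↥(pbox (Mc B))) : Site (3 + 1))) (μ := μ) (hfa := hfN n B (wrapPt (Mc B) y, μ)) (c := (sn n) * (r n))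
    (lv := (lv n) B) (hlve := hlve n B) (s := s)
  rw [lamRecGS_QSym_eq_lamZ]
  exact h57

end Summit.QuantumFields.BalabanUV.Beta.FP.TowerDoorRecordGaugeLetterGS

end
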